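import Summits.KontsevichZagierPeriods.KontsevichZagierPeriods.Theorems.StuffleInKZ.Negative.Core

/-!
# `StuffleInKZ` (stmt-KontsevichZagierPeriods-3931): negative side — graded evaluation, the
# Newton–Leibniz-free sub-calculus, and the independence of rule (3)

Companion of `Negative/Core.lean` (cdisprove unit of the crux `StuffleInKZ`, route
`FurushoPentagon`). The invariant: **graded evaluation** `gradedEval N [r] = value r` if
`dim r = N`, `0` otherwise. Each generator of rules (1a), (1b) domain/integrand additivity and
(2) change of variables lives in ONE dimension and evaluates to `0` there, so the
Newton–Leibniz-free closure `nlFreeRelations = closure (domainAddRel ∪ integrandAddRel ∪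
changeOfVariablesRel)` lies in `⋂_N ker (gradedEval N)` (`nlFreeRelations_le_ker_gradedEval`).
Consequences PROVED here:

* TIGHTNESS for the crux: the stuffle defect is homogeneous of dimension `|s| + |t|`
  (`MZV.sum_of_mem_stuffle`) and evaluates to `0` there, so `gradedEval_defect = 0` in every
  degree — graded evaluation does NOT obstruct a Newton–Leibniz-free move chain for the stuffle
  (consistent with the expected proof by cubical coordinates, which uses only (1b) + (2):
  Soudères 2010, Prop. 1.5);
* INDEPENDENCE of rule (3): `∫₀¹ dt − [pt, 1]` is ONE Newton–Leibniz move
  (`of_segRep_sub_of_unit_mem_newtonLeibnizRel`) of graded evaluation `1` in degree `1`, hence not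
  in the NL-free closure: `nlFreeRelations < relations` strictly (`nlFreeRelations_lt_relations`),
  and the kernel conjecture FAILS for the NL-free calculus (`not_kernel_le_nlFree`) — any proof of
  Conjecture 1 must use rule (3), although for the stuffle itself no NL-obstruction is visible.

Sources: M. Kontsevich, D. Zagier, *Periods* (2001), §1.2 rules (1)–(3); I. Soudères, *Motivic
double shuffle*, Int. J. Number Theory 6 (2010), Prop. 1.5.
-/

noncomputable section

namespace Summit.KontsevichZagierPeriods.Theorems.StuffleInKZ.Negative

open MeasureTheory Set
open Literature.NumberTheory.Transcendental
open Literature.NumberTheory.Transcendental.KZ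
open MvPolynomial (aeval X C)
open Literature.NumberTheory.Transcendental.MZV (IsAdmissible stuffle weight isAdmissible_nil
  isAdmissible_of_mem_stuffle stuffle_cons_cons stuffle_nil_left stuffle_nil_right sum_of_mem_stuffle)
open Summit.KontsevichZagierPeriods.KontsevichZagierPeriods.Theses.FurushoPentagon (StuffleInKZ)

variable {n m : ℕ}

/-! ## §1 Graded evaluation and the Newton–Leibniz-free closure -/

/-- **Graded evaluation** `gradedEval N [r] = value r` if `dim r = N`, else `0`. [folklore] -/
def gradedEval (N : ℕ) : FormalRep →+ ℝ :=
  FreeAbelianGroup.lift fun r => if r.1 = N then r.2.value else 0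

/-- `gradedEval N [r]` on a generator. [folklore] -/
@[simp] theorem gradedEval_of (N : ℕ) (r : IntegralRep n) :
    gradedEval N (of r) = if n = N then r.value else 0 :=
  FreeAbelianGroup.lift_apply_of _ _

/-- The closure of (1a) + (1b) + (2): the KZ calculus WITHOUT Newton–Leibniz (the analogue, for
`KZ.FormalRep`, of the exponential calculus' `KZexp.nlFreeRelations` of `KZExpCalculus.lean`,
which lives on `KZexp.FormalRep`). [folklore] -/
def nlFreeRelations : AddSubgroup FormalRep :=
  AddSubgroup.closure (domainAddRel ∪ integrandAddRel ∪ changeOfVariablesRel)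

/-- The NL-free closure is part of `KZ.relations` (cf. `KZexp.nlFreeRelations_le_relations` for the
exponential calculus). [folklore] -/
theorem nlFreeRelations_le_relations : nlFreeRelations ≤ relations :=
  AddSubgroup.closure_mono fun _ hc => Or.inl hc

/-- **Rules (1), (2) preserve evaluation DEGREE BY DEGREE** (each of their generators lives in one
dimension and evaluates to `0` there: `KZ.eval_eq_zero_of_mem_*_holds`). [folklore] -/
theorem nlFreeRelations_le_ker_gradedEval (N : ℕ) : nlFreeRelations ≤ (gradedEval N).ker := by
  refine (AddSubgroup.closure_le _).mpr ?_
  rintro c ((hc | hc) | hc)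
  · have h0 : eval c = 0 := eval_eq_zero_of_mem_domainAddRel_holds hc
    obtain ⟨k, r, r₁, r₂, -, -, -, -, rfl⟩ := hc
    simp only [map_sub, eval_of] at h0
    simp only [SetLike.mem_coe, AddMonoidHom.mem_ker, map_sub, gradedEval_of]
    by_cases hk : k = N <;> simp [hk, h0]
  · have h0 : eval c = 0 := eval_eq_zero_of_mem_integrandAddRel_holds hc
    obtain ⟨k, r, r₁, r₂, -, -, -, rfl⟩ := hc
    simp only [map_sub, eval_of] at h0
    simp only [SetLike.mem_coe, AddMonoidHom.mem_ker, map_sub, gradedEval_of]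
    by_cases hk : k = N <;> simp [hk, h0]
  · have h0 : eval c = 0 := eval_eq_zero_of_mem_changeOfVariablesRel_holds hc
    obtain ⟨k, r, r', -, -, -, -, -, -, -, rfl⟩ := hc
    simp only [map_sub, eval_of] at h0
    simp only [SetLike.mem_coe, AddMonoidHom.mem_ker, map_sub, gradedEval_of]
    by_cases hk : k = N <;> simp [hk, h0]

/-! ## §2 Tightness: no graded-evaluation obstruction for the stuffle -/

/-- Graded evaluation of a simplex class. [folklore] -/
theorem gradedEval_simplexOf (N : ℕ) (u : List ℕ) (hu : IsAdmissible u) :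
    gradedEval N (simplexOf u hu) = if weight u = N then multipleZeta u else 0 := by
  rw [simplexOf, gradedEval_of, mzvRep_value_holds]

/-- `[Δ_s]·[Δ_t] = [Δ_s × Δ_t]` (`KZ.of_mul_of`), stated for `simplexOf`. [folklore] -/
theorem simplexOf_mul_simplexOf_eq {s t : List ℕ} (hs : IsAdmissible s) (ht : IsAdmissible t) :
    simplexOf s hs * simplexOf t ht =
      of ((mzvRep s hs (mzvIntegrand_isSemialgebraicFunOn_holds s)
        (mzvIntegrand_integrableOn_holds s hs)).prod
        (mzvRep t ht (mzvIntegrand_isSemialgebraicFunOn_holds t)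
          (mzvIntegrand_integrableOn_holds t ht))) :=
  of_mul_of _ _

/-- **Tightness**: graded evaluation does NOT obstruct an NL-free chain for the stuffle — the
defect is homogeneous of dimension `|s| + |t|` (`MZV.sum_of_mem_stuffle`) and evaluates to `0`
there (Hoffman's theorem `multipleZeta_mul`). [folklore] -/
theorem gradedEval_defect (N : ℕ) {s t : List ℕ} (hs : IsAdmissible s) (ht : IsAdmissible t) :
    gradedEval N (defect Zcan s t) = 0 := by
  rw [defect, map_sub, Zcan_of_isAdmissible s hs, Zcan_of_isAdmissible t ht,
    simplexOf_mul_simplexOf_eq, gradedEval_of, IntegralRep.value_prod, mzvRep_value_holds,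
    mzvRep_value_holds, map_list_sum, List.map_map]
  have hcongr : ∀ u ∈ stuffle s t, (gradedEval N ∘ Zcan) u =
      (fun u => if weight s + weight t = N then multipleZeta u else 0) u := by
    intro u hu
    rw [Function.comp_apply, Zcan_of_isAdmissible u (isAdmissible_of_mem_stuffle hs ht hu),
      gradedEval_simplexOf]
    have hw : weight u = weight s + weight t := sum_of_mem_stuffle s t hu
    rw [hw]
  rw [List.map_congr_left hcongr]
  by_cases h : weight s + weight t = N
  · simp only [h, if_true]
    rw [multipleZeta_mul hs ht, sub_eq_zero]
  · simp only [h, if_false, List.map_const', List.sum_replicate, smul_zero, sub_zero]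

/-! ## §3 Independence of rule (3): `∫₀¹ dt = 1` is not an NL-free relation -/

/-- The unit cube of `ℝ^{0+1}` is `ℚ`-semialgebraic. [folklore] -/
theorem isSemialgebraic_unitCube :
    Literature.ModelTheory.ExponentialFields.IsSemialgebraic ℚ
      (Set.pi univ fun _ : Fin (0 + 1) => Icc (0 : ℝ) 1) := by
  have h : (Set.pi univ fun _ : Fin (0 + 1) => Icc (0 : ℝ) 1) =
      {z | aeval z (0 : MvPolynomial (Fin (0 + 1)) ℚ) ≤
          aeval z (X (Fin.last 0) : MvPolynomial (Fin (0 + 1)) ℚ)} ∩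
        {z | aeval z (X (Fin.last 0) : MvPolynomial (Fin (0 + 1)) ℚ) ≤
          aeval z (1 : MvPolynomial (Fin (0 + 1)) ℚ)} := by
    ext z
    simp [Pi.le_def, Fin.forall_fin_one]
  rw [h]
  exact (Literature.ModelTheory.ExponentialFields.isSemialgebraic_setOf_eval_le _ _).inter
    (Literature.ModelTheory.ExponentialFields.isSemialgebraic_setOf_eval_le _ _)

/-- The segment `[0, 1] ⊆ ℝ¹` with integrand `1`, i.e. `∫₀¹ dt` (dimension written `0 + 1`: it is a
Newton–Leibniz band over the point `ℝ⁰`). [folklore] -/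
def segRep : IntegralRep (0 + 1) where
  domain := Set.pi univ fun _ => Icc 0 1
  integrand := fun _ => 1
  isSemialgebraic_domain := isSemialgebraic_unitCube
  isSemialgebraicFunOn_integrand := by
    simpa using isSemialgebraicFunOn_aeval isSemialgebraic_unitCube (1 : MvPolynomial (Fin (0 + 1)) ℚ)
  integrableOn := by
    refine integrableOn_const ?_
    rw [volume_pi_pi]
    simp

/-- The segment has volume `1`. [folklore] -/
theorem volume_segRep_domain : volume segRep.domain = 1 := by
  show volume (Set.pi univ fun _ : Fin (0 + 1) => Icc (0 : ℝ) 1) = 1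
  rw [volume_pi_pi]
  simp

/-- `∫₀¹ dt = 1`. [folklore] -/
@[simp] theorem value_segRep : segRep.value = 1 := by
  rw [IntegralRep.value]
  show ∫ _ in segRep.domain, (1 : ℝ) = 1
  rw [setIntegral_const, measureReal_def, volume_segRep_domain]
  simp

/-- **`∫₀¹ dt = [pt, 1]` is ONE Newton–Leibniz move**: band over `τ = ℝ⁰` with `a = 0`, `b = 1`,
primitive `F (t) = t`. [folklore] -/
theorem of_segRep_sub_of_unit_mem_newtonLeibnizRel :
    of segRep - of IntegralRep.unit ∈ newtonLeibnizRel := by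
  refine ⟨0, segRep, IntegralRep.unit, fun _ => 0, fun _ => 1, fun z => z (Fin.last 0),
    ?_, ?_, ?_, ?_, ?_, ?_, ?_, ?_, rfl⟩
  · simpa using isSemialgebraicFunOn_aeval segRep.isSemialgebraic_domain
      (X (Fin.last 0) : MvPolynomial (Fin (0 + 1)) ℚ)
  · simpa using isSemialgebraicFunOn_aeval IntegralRep.unit.isSemialgebraic_domain
      (0 : MvPolynomial (Fin 0) ℚ)
  · simpa using isSemialgebraicFunOn_aeval IntegralRep.unit.isSemialgebraic_domain
      (1 : MvPolynomial (Fin 0) ℚ)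
  · intro x _
    norm_num
  · ext z
    simp [segRep, Pi.le_def, Fin.forall_fin_one]
  · intro x _
    simp only [Fin.snoc_last]
    exact continuousOn_id
  · intro x _ t _
    simp only [Fin.snoc_last]
    exact hasDerivAt_id t
  · intro x _
    simp only [Fin.snoc_last, IntegralRep.unit_integrand]
    norm_num

/-- Hence `∫₀¹ dt − [pt,1]` is a relation … [folklore] -/
theorem of_segRep_sub_of_unit_mem_relations : of segRep - of IntegralRep.unit ∈ relations :=
  newtonLeibnizRel_subset_relations of_segRep_sub_of_unit_mem_newtonLeibnizRel

/-- … of evaluation `0` … [folklore] -/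
theorem eval_segRep_sub_unit : eval (of segRep - of IntegralRep.unit) = 0 := by
  simp

/-- … but of graded evaluation `1` in degree `1` … [folklore] -/
theorem gradedEval_one_segRep_sub_unit : gradedEval 1 (of segRep - of IntegralRep.unit) = 1 := by
  simp

/-- … hence NOT in the NL-free closure. [folklore] -/
theorem of_segRep_sub_of_unit_not_mem_nlFree : of segRep - of IntegralRep.unit ∉ nlFreeRelations :=
  fun h => by
  have h0 := nlFreeRelations_le_ker_gradedEval 1 h
  rw [AddMonoidHom.mem_ker, gradedEval_one_segRep_sub_unit] at h0
  exact one_ne_zero h0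

/-- **Rule (3) is independent of rules (1), (2)**: the NL-free closure is a PROPER subgroup of
`relations`. [folklore] -/
theorem nlFreeRelations_lt_relations : nlFreeRelations < relations :=
  lt_of_le_of_ne nlFreeRelations_le_relations fun h =>
    of_segRep_sub_of_unit_not_mem_nlFree (h ▸ of_segRep_sub_of_unit_mem_relations)

/-- **Refuted strengthening**: the kernel conjecture FAILS for the NL-free calculus —
`∫₀¹ dt − [pt, 1]` evaluates to `0` but is not an NL-free relation. (So any proof of Conjecture 1
must use rule (3); for the stuffle itself, however, no NL-obstruction is visible:
`gradedEval_defect`.) [folklore] -/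
theorem not_kernel_le_nlFree : ¬ ∀ c : FormalRep, eval c = 0 → c ∈ nlFreeRelations := fun h =>
  of_segRep_sub_of_unit_not_mem_nlFree (h _ eval_segRep_sub_unit)

end Summit.KontsevichZagierPeriods.Theorems.StuffleInKZ.Negative
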